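import Summits.ValiantsHypothesis.ValiantsHypothesis.Theorems.DivisionGapAssembly
import Summits.ValiantsHypothesis.ValiantsHypothesis.Theorems.DivisionGapPerNotVPToVH

/-!
# The UNCHARGED spine of route DivisionGap: `PerMultiplesHard → MonotoneMultiples → ValiantsHypothesis`

Support file for crux `stmt-ValiantsHypothesis-5066` (`ZeroOneTransfer`, H2), line `charged-uncharged`
(lead c8, 2026-08-17).  The route's deciding theorem is the CHARGED spine
`closes : PerDivisionHard → ZeroOneTransfer → ValiantsHypothesis` (H1 charged, H2 charged).  The
line splits H2 as `ZeroOneTransfer ↔ MonotoneMultiples ∧ CofactorCharging`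
(`Theorems/DivisionGapZeroOneTransferSplit.lean`).  This file records, kernel-checked, the
strategist's route-level corollary (STRATEGY-CENSUS.md §3d): the summit statement already follows
from the UNCHARGED H2-child `MonotoneMultiples` alone, provided H1 is taken in its uncharged form
`PerMultiplesHard` (route item #9, stmt-ValiantsHypothesis-5068, HY21 Problem 2 for `per` verbatim):

`valiantsHypothesis_of_perMultiplesHard_of_monotoneMultiples :
  PerMultiplesHard → MonotoneMultiples → ValiantsHypothesis`  (MonotoneMultiples stated inline).

So `CofactorCharging` — the child where Pfaffian parity bites — is NOT on this alternative critical
path; the price is the stronger H1.  Proof: three lines over the tree — `per` over `ℝ≥0` has 0/1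
coefficients and complexifies to `per` over `ℂ` (`DivisionGap.coeff_perPoly_nnreal_eq_zero_or_eq_one`,
`DivisionGap.map_perPoly_nnreal_family`), so if `per ∈ VP_ℂ` then MM gives `c` and, for every `n`,
a nonzero `h` with `L₊(per_n · h) ≤ 2^((log₂ n + c)^c)`, contradicting `PerMultiplesHard` at
`n := n₀(c)`; and `per ∉ VP_ℂ → ValiantsHypothesis` is the proved support `perNotVPToVH_proof`.
-/

-- Sub = Summit single-conjunct layout: the duplicated namespace component is mandated by the tree.
set_option linter.dupNamespace false

namespace Summit.ValiantsHypothesis.ValiantsHypothesis.Theorems.DivisionGapZeroOneTransfer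

open Literature.Computability.AlgebraicComplexity
open Summit.ValiantsHypothesis.ValiantsHypothesis.Theses.DivisionGap

/-- **`per ∉ VP_ℂ` from the uncharged pair**: if every nonzero monotone multiple `per_n · h` is
eventually super-quasi-polynomial (`PerMultiplesHard`) and every 0/1-coefficient `VP_ℂ` family has
SOME nonzero multiple of quasi-polynomial monotone complexity (MonotoneMultiples, inline), then the
permanent family is not in `VP_ℂ`. [folklore] -/
theorem not_isVPFamily_per_of_perMultiplesHard_of_monotoneMultiples
    (h1 : PerMultiplesHard)
    (hMM : ∀ (σ : ℕ → Type) [∀ n, Fintype (σ n)] (f : ∀ n, MvPolynomial (σ n) NNReal),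
      (∀ n m, MvPolynomial.coeff m (f n) = 0 ∨ MvPolynomial.coeff m (f n) = 1) →
      Literature.Computability.AlgebraicComplexity.IsVPFamily (k := ℂ)
        (fun n => MvPolynomial.map (Complex.ofRealHom.comp NNReal.toRealHom) (f n)) →
      ∃ c : ℕ, ∀ n, ∃ h : MvPolynomial (σ n) NNReal, h ≠ 0 ∧
        Literature.Computability.AlgebraicComplexity.complexity (f n * h) ≤
          2 ^ ((Nat.log 2 n + c) ^ c)) :
    ¬ IsVPFamily (k := ℂ) (fun n => perPoly (Fin n) ℂ) := by
  intro hVP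
  have hVP' : IsVPFamily (k := ℂ)
      (fun n => MvPolynomial.map (Complex.ofRealHom.comp NNReal.toRealHom)
        (perPoly (Fin n) NNReal)) := by
    rw [DivisionGap.map_perPoly_nnreal_family]; exact hVP
  obtain ⟨c, hc⟩ := hMM (fun n => Fin n × Fin n) (fun n => perPoly (Fin n) NNReal)
    DivisionGap.coeff_perPoly_nnreal_eq_zero_or_eq_one hVP'
  obtain ⟨n₀, hn₀⟩ := h1 c
  obtain ⟨h, hne, hle⟩ := hc n₀
  exact absurd (hn₀ n₀ le_rfl h hne) (not_lt.mpr hle)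

/-- **The uncharged spine (registered stub `valiantsHypothesis_of_perMultiplesHard_of_monotoneMultiples`).**
`PerMultiplesHard → MonotoneMultiples → ValiantsHypothesis` (MonotoneMultiples = the uncharged
child of H2, stated inline): an alternative deciding theorem for route DivisionGap in which the
H2 side needs only the UNCHARGED transfer and `CofactorCharging` is off the critical path.
Proof: `not_isVPFamily_per_of_perMultiplesHard_of_monotoneMultiples` and the proved support
`perNotVPToVH_proof : ¬ IsVPFamily_ℂ per → ValiantsHypothesis`. [folklore] -/
theorem valiantsHypothesis_of_perMultiplesHard_of_monotoneMultiples :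
    Summit.ValiantsHypothesis.ValiantsHypothesis.Theses.DivisionGap.PerMultiplesHard →
    (∀ (σ : ℕ → Type) [∀ n, Fintype (σ n)] (f : ∀ n, MvPolynomial (σ n) NNReal),
      (∀ n m, MvPolynomial.coeff m (f n) = 0 ∨ MvPolynomial.coeff m (f n) = 1) →
      Literature.Computability.AlgebraicComplexity.IsVPFamily (k := ℂ)
        (fun n => MvPolynomial.map (Complex.ofRealHom.comp NNReal.toRealHom) (f n)) →
      ∃ c : ℕ, ∀ n, ∃ h : MvPolynomial (σ n) NNReal, h ≠ 0 ∧
        Literature.Computability.AlgebraicComplexity.complexity (f n * h) ≤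
          2 ^ ((Nat.log 2 n + c) ^ c)) →
    _root_.ValiantsHypothesis := by
  intro h1 hMM
  exact Summit.ValiantsHypothesis.Theorems.perNotVPToVH_proof
    (not_isVPFamily_per_of_perMultiplesHard_of_monotoneMultiples h1 hMM)

end Summit.ValiantsHypothesis.ValiantsHypothesis.Theorems.DivisionGapZeroOneTransfer
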